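import Mathlib
/-! # Stub `stub_sweep` — crux `TwoProducts` (stmt-ValiantsHypothesis-5906), line `corner-log-linearization`

Plane geometry of integer weight vectors: for a finite `D ⊂ ℤ²` the critical lines
`⟨w, d⟩ = 0` (`d ∈ D`) and the two axes cut weight space into at most `4|D| + 4` open cones
("sectors"), each the positive cone over two independent integer boundary vectors `(r₁, r₂)`
of its closure, with weak sign consistency `⟨w, d⟩ > 0 ⇒ ⟨r₁, d⟩ ≥ 0 ∧ ⟨r₂, d⟩ ≥ 0` on `D`.
Proof: reduce to the open positive quadrant by the four coordinate reflections; there the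
sectors are indexed by the positive critical slopes `c ∈ ℚ`, with boundary vectors
`(c.den, c.num)` and `(0, 1)`; `⟨(q, p), d⟩ = q · (d₀ + (p/q) d₁)` is affine in the slope
`p/q`, so its sign can only change at a critical slope; `a, b, K` by Cramer's rule.
[folklore] -/
set_option linter.dupNamespace false -- single-conjunct summit: `ValiantsHypothesis.ValiantsHypothesis`
namespace Summit.ValiantsHypothesis.ValiantsHypothesis.Theorems.TwoProducts.Sweep
open scoped BigOperators

/-! ## Affine sign argument over `ℚ` -/

/-- If the affine function `s ↦ a + s * b` takes values of opposite strict signs at `x < y`, then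
`b ≠ 0` and its root `-a / b` lies strictly between `x` and `y`. [folklore] -/
theorem root_between_rat {a b x y : ℚ} (hxy : x < y) (h : (a + x * b) * (a + y * b) < 0) :
    b ≠ 0 ∧ x < -a / b ∧ -a / b < y := by
  have hb : b ≠ 0 := by
    rintro rfl
    have h0 : 0 ≤ (a + x * 0) * (a + y * 0) := by
      rw [mul_zero, mul_zero, add_zero]; exact mul_self_nonneg a
    exact absurd h (not_lt.mpr h0)
  have key : (a + x * b) * (a + y * b) = b ^ 2 * ((x - -a / b) * (y - -a / b)) := by
    field_simp
    ring
  have hP : (x - -a / b) * (y - -a / b) < 0 :=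
    lt_of_mul_lt_mul_left (by rw [mul_zero, ← key]; exact h) (sq_nonneg b)
  refine ⟨hb, ?_, ?_⟩
  · by_contra hx
    have hx' := not_lt.mp hx
    exact absurd hP (not_lt.mpr
      (mul_nonneg (sub_nonneg.mpr hx') (sub_nonneg.mpr (hx'.trans hxy.le))))
  · by_contra hy
    have hy' := not_lt.mp hy
    exact absurd hP (not_lt.mpr (mul_nonneg_of_nonpos_of_nonpos
      (sub_nonpos.mpr (hxy.le.trans hy')) (sub_nonpos.mpr hy')))

/-- `⟨(q, p), d⟩ = q · (d₀ + (p / q) · d₁)` over `ℚ`, for `q ≠ 0`. [folklore] -/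
theorem inner_eq_mul_affine (q p d0 d1 : ℤ) (hq : q ≠ 0) :
    ((q * d0 + p * d1 : ℤ) : ℚ) = (q : ℚ) * ((d0 : ℚ) + (p : ℚ) / q * d1) := by
  have hq' : (q : ℚ) ≠ 0 := by exact_mod_cast hq
  push_cast
  rw [mul_add, ← mul_assoc, mul_comm (q : ℚ) ((p : ℚ) / q), div_mul_cancel₀ _ hq']

/-- Orientation from slopes: for `q₁, q₂ > 0`, `p₁/q₁ < p₂/q₂` implies
`det((q₁,p₁),(q₂,p₂)) > 0`. [folklore] -/
theorem det_pos_of_slope_lt (q1 p1 q2 p2 : ℤ) (hq1 : 0 < q1) (hq2 : 0 < q2)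
    (h : (p1 : ℚ) / q1 < (p2 : ℚ) / q2) : 0 < q1 * p2 - p1 * q2 := by
  rw [div_lt_div_iff₀ (by exact_mod_cast hq1) (by exact_mod_cast hq2)] at h
  have h' : p1 * q2 < p2 * q1 := by exact_mod_cast h
  linarith

/-- Opposite strict signs of `⟨(q₁,p₁), d⟩` and `⟨(q₂,p₂), d⟩` (`q₁, q₂ > 0`, slopes
`p₁/q₁ < p₂/q₂`) put the critical slope `-d₀/d₁` of `d` strictly between the two slopes.
[folklore] -/
theorem slope_root_between (q1 p1 q2 p2 d0 d1 : ℤ) (hq1 : 0 < q1) (hq2 : 0 < q2)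
    (hlt : (p1 : ℚ) / q1 < (p2 : ℚ) / q2)
    (hsign : (q1 * d0 + p1 * d1) * (q2 * d0 + p2 * d1) < 0) :
    (p1 : ℚ) / q1 < -(d0 : ℚ) / d1 ∧ -(d0 : ℚ) / d1 < (p2 : ℚ) / q2 := by
  have hcast : ((q1 * d0 + p1 * d1 : ℤ) : ℚ) * ((q2 * d0 + p2 * d1 : ℤ) : ℚ) < 0 := by
    exact_mod_cast hsign
  rw [inner_eq_mul_affine q1 p1 d0 d1 hq1.ne', inner_eq_mul_affine q2 p2 d0 d1 hq2.ne'] at hcast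
  have hprod : ((d0 : ℚ) + (p1 : ℚ) / q1 * d1) * ((d0 : ℚ) + (p2 : ℚ) / q2 * d1) < 0 := by
    have hqq : (0 : ℚ) ≤ (q1 : ℚ) * q2 := by positivity
    refine lt_of_mul_lt_mul_left ?_ hqq
    rw [mul_zero]
    calc (q1 : ℚ) * q2 *
          (((d0 : ℚ) + (p1 : ℚ) / q1 * d1) * ((d0 : ℚ) + (p2 : ℚ) / q2 * d1))
        = (q1 : ℚ) * ((d0 : ℚ) + (p1 : ℚ) / q1 * d1) *
            ((q2 : ℚ) * ((d0 : ℚ) + (p2 : ℚ) / q2 * d1)) := by ring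
      _ < 0 := hcast
  obtain ⟨-, h1, h2⟩ := root_between_rat hlt hprod
  exact ⟨h1, h2⟩

/-! ## The three kinds of sector boundaries in the open positive quadrant -/

/-- Lower boundary `r₁ = (c.den, c.num)` of the sector of `w` (`w₀ > 0`): if
`c < σ := w₁/w₀` and no critical slope of `D` lies in `(c, σ)`, then `det(r₁, w) > 0` and
`⟨w,d⟩ > 0 ⇒ ⟨r₁,d⟩ ≥ 0` on `D`. [folklore] -/
theorem lower_side (D : Finset (Fin 2 → ℤ)) (w : Fin 2 → ℤ) (hw0 : 0 < w 0) (c : ℚ)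
    (hcσ : c < (w 1 : ℚ) / w 0)
    (hgap : ∀ d ∈ D,
      c < -(d 0 : ℚ) / d 1 → -(d 0 : ℚ) / d 1 < (w 1 : ℚ) / w 0 → False) :
    0 < (c.den : ℤ) * w 1 - c.num * w 0 ∧
      ∀ d ∈ D, 0 < w 0 * d 0 + w 1 * d 1 → 0 ≤ (c.den : ℤ) * d 0 + c.num * d 1 := by
  have hden : (0 : ℤ) < c.den := Int.natCast_pos.mpr c.den_pos
  have hslope : ((c.num : ℤ) : ℚ) / ((c.den : ℤ) : ℚ) = c := by
    rw [Int.cast_natCast]; exact Rat.num_div_den c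
  refine ⟨det_pos_of_slope_lt _ _ _ _ hden hw0 (by rwa [hslope]), fun d hd hpos => ?_⟩
  by_contra hneg
  have hsign : ((c.den : ℤ) * d 0 + c.num * d 1) * (w 0 * d 0 + w 1 * d 1) < 0 :=
    mul_neg_of_neg_of_pos (not_le.mp hneg) hpos
  obtain ⟨h1, h2⟩ := slope_root_between _ _ _ _ _ _ hden hw0 (by rwa [hslope]) hsign
  rw [hslope] at h1
  exact hgap d hd h1 h2

/-- Finite upper boundary `r₂ = (c.den, c.num)` of the sector of `w` (`w₀ > 0`): if
`σ := w₁/w₀ < c` and no critical slope of `D` lies in `(σ, c)`, then `det(w, r₂) > 0` and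
`⟨w,d⟩ > 0 ⇒ ⟨r₂,d⟩ ≥ 0` on `D`. [folklore] -/
theorem upper_side (D : Finset (Fin 2 → ℤ)) (w : Fin 2 → ℤ) (hw0 : 0 < w 0) (c : ℚ)
    (hσc : (w 1 : ℚ) / w 0 < c)
    (hgap : ∀ d ∈ D,
      (w 1 : ℚ) / w 0 < -(d 0 : ℚ) / d 1 → -(d 0 : ℚ) / d 1 < c → False) :
    0 < w 0 * c.num - w 1 * c.den ∧
      ∀ d ∈ D, 0 < w 0 * d 0 + w 1 * d 1 → 0 ≤ (c.den : ℤ) * d 0 + c.num * d 1 := by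
  have hden : (0 : ℤ) < c.den := Int.natCast_pos.mpr c.den_pos
  have hslope : ((c.num : ℤ) : ℚ) / ((c.den : ℤ) : ℚ) = c := by
    rw [Int.cast_natCast]; exact Rat.num_div_den c
  refine ⟨det_pos_of_slope_lt _ _ _ _ hw0 hden (by rwa [hslope]), fun d hd hpos => ?_⟩
  by_contra hneg
  have hsign : (w 0 * d 0 + w 1 * d 1) * ((c.den : ℤ) * d 0 + c.num * d 1) < 0 :=
    mul_neg_of_pos_of_neg hpos (not_le.mp hneg)
  obtain ⟨h1, h2⟩ := slope_root_between _ _ _ _ _ _ hw0 hden (by rwa [hslope]) hsign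
  rw [hslope] at h2
  exact hgap d hd h1 h2

/-- Upper boundary `r₂ = (0, 1)` of the top sector of `w` (`w₀ > 0`): if no critical slope
of `D` exceeds `σ := w₁/w₀`, then `⟨w,d⟩ > 0 ⇒ ⟨(0,1),d⟩ = d₁ ≥ 0` on `D`. [folklore] -/
theorem top_side (D : Finset (Fin 2 → ℤ)) (w : Fin 2 → ℤ) (hw0 : 0 < w 0)
    (hgap : ∀ d ∈ D, (w 1 : ℚ) / w 0 < -(d 0 : ℚ) / d 1 → False) :
    ∀ d ∈ D, 0 < w 0 * d 0 + w 1 * d 1 → 0 ≤ d 1 := by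
  intro d hd hpos
  by_contra hneg
  have hd1 : d 1 < 0 := not_le.mp hneg
  have hd1' : (d 1 : ℚ) < 0 := by exact_mod_cast hd1
  refine hgap d hd ?_
  rw [lt_div_iff_of_neg hd1']
  have hposQ : (0 : ℚ) < ((w 0 * d 0 + w 1 * d 1 : ℤ) : ℚ) := by exact_mod_cast hpos
  rw [inner_eq_mul_affine _ _ _ _ hw0.ne'] at hposQ
  have hw0' : (0 : ℚ) < w 0 := by exact_mod_cast hw0
  have := (mul_pos_iff_of_pos_left hw0').mp hposQ
  linarith

/-! ## The quadrant lemma, its reflections, and the stub -/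

/-- QUADRANT LEMMA.  At most `|D| + 1` positively oriented pairs `(r₁, r₂)` of integer
vectors of the closed positive quadrant such that every `w` with `w₀, w₁ > 0` off the critical
lines of `D` lies strictly inside one of them (`det(w, r₂) > 0`, `det(r₁, w) > 0`), with weak
sign consistency on `D`. [folklore] -/
theorem quadrant (D : Finset (Fin 2 → ℤ)) :
    ∃ Sec : Finset ((Fin 2 → ℤ) × (Fin 2 → ℤ)), Sec.card ≤ D.card + 1 ∧
      ∀ w : Fin 2 → ℤ, 0 < w 0 → 0 < w 1 → (∀ d ∈ D, w 0 * d 0 + w 1 * d 1 ≠ 0) →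
        ∃ rr ∈ Sec, 0 < rr.1 0 * rr.2 1 - rr.1 1 * rr.2 0 ∧
          0 < w 0 * rr.2 1 - w 1 * rr.2 0 ∧ 0 < rr.1 0 * w 1 - rr.1 1 * w 0 ∧
            ∀ d ∈ D, 0 < w 0 * d 0 + w 1 * d 1 →
              0 ≤ rr.1 0 * d 0 + rr.1 1 * d 1 ∧ 0 ≤ rr.2 0 * d 0 + rr.2 1 * d 1 := by
  -- the positive critical slopes
  obtain ⟨C, hCcard, hCmem, hCD⟩ : ∃ C : Finset ℚ, C.card ≤ D.card ∧
      (∀ d ∈ D, 0 < -(d 0 : ℚ) / d 1 → -(d 0 : ℚ) / d 1 ∈ C) ∧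
      (∀ c ∈ C, 0 < c ∧ ∃ d ∈ D, -(d 0 : ℚ) / d 1 = c) := by
    refine ⟨(D.image fun d : Fin 2 → ℤ => -(d 0 : ℚ) / d 1).filter (fun c => 0 < c),
      (Finset.card_filter_le _ _).trans Finset.card_image_le,
      fun d hd hpos => Finset.mem_filter.mpr ⟨Finset.mem_image_of_mem _ hd, hpos⟩,
      fun c hc => ?_⟩
    obtain ⟨hc1, hc2⟩ := Finset.mem_filter.mp hc
    exact ⟨hc2, Finset.mem_image.mp hc1⟩
  -- boundary vector of a slope, previous critical slope (or `0`), largest critical slope (or `0`)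
  obtain ⟨vec, hvec⟩ :
      ∃ vec : ℚ → (Fin 2 → ℤ), ∀ c, vec c = ![(c.den : ℤ), c.num] := ⟨_, fun _ => rfl⟩
  obtain ⟨prev, hprev⟩ : ∃ prev : ℚ → ℚ, ∀ c, prev c =
      (insert (0 : ℚ) (C.filter fun c' => c' < c)).max' (Finset.insert_nonempty 0 _) :=
    ⟨_, fun _ => rfl⟩
  obtain ⟨cmax, hmax_mem, hmax_ge⟩ : ∃ cmax, cmax ∈ insert (0 : ℚ) C ∧
      ∀ c ∈ insert (0 : ℚ) C, c ≤ cmax :=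
    ⟨_, Finset.max'_mem _ (Finset.insert_nonempty 0 C), fun c hc => Finset.le_max' _ _ hc⟩
  refine ⟨insert (vec cmax, ![0, 1]) (C.image fun c => (vec (prev c), vec c)), ?_, ?_⟩
  · calc (insert (vec cmax, ![0, 1]) (C.image fun c => (vec (prev c), vec c))).card
        ≤ (C.image fun c => (vec (prev c), vec c)).card + 1 := Finset.card_insert_le _ _
      _ ≤ D.card + 1 := Nat.add_le_add_right (Finset.card_image_le.trans hCcard) 1
  intro w hw0 hw1 hadm
  have hw0' : (0 : ℚ) < w 0 := by exact_mod_cast hw0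
  have hσpos : (0 : ℚ) < (w 1 : ℚ) / w 0 := div_pos (by exact_mod_cast hw1) hw0'
  -- the slope of `w` is not critical
  have hσC : (w 1 : ℚ) / w 0 ∉ C := by
    intro hmem
    obtain ⟨-, d, hd, hdeq⟩ := hCD _ hmem
    have hd1 : (d 1 : ℚ) ≠ 0 := by
      intro h0
      rw [h0, div_zero] at hdeq
      exact hσpos.ne hdeq
    rw [div_eq_div_iff hd1 hw0'.ne'] at hdeq
    have h' : -d 0 * w 0 = w 1 * d 1 := by exact_mod_cast hdeq
    exact hadm d hd (by linarith)
  by_cases hU : (C.filter fun c => (w 1 : ℚ) / w 0 < c).Nonempty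
  · -- a sector between two consecutive critical slopes `prev chi < σ < chi`
    obtain ⟨chi, ⟨hchiC, hσchi⟩, hchi_le⟩ :
        ∃ chi, (chi ∈ C ∧ (w 1 : ℚ) / w 0 < chi) ∧ ∀ c ∈ C, (w 1 : ℚ) / w 0 < c → chi ≤ c :=
      ⟨_, Finset.mem_filter.mp (Finset.min'_mem _ hU),
        fun c hc hlt => Finset.min'_le _ _ (Finset.mem_filter.mpr ⟨hc, hlt⟩)⟩
    have hlo_mem : prev chi ∈ insert (0 : ℚ) (C.filter fun c' => c' < chi) := by
      rw [hprev]; exact Finset.max'_mem _ _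
    have hlo_ge : ∀ c ∈ insert (0 : ℚ) (C.filter fun c' => c' < chi), c ≤ prev chi :=
      fun c hc => by rw [hprev]; exact Finset.le_max' _ _ hc
    have hlo_nonneg : 0 ≤ prev chi := hlo_ge 0 (Finset.mem_insert_self _ _)
    have hlo_lt : prev chi < (w 1 : ℚ) / w 0 := by
      rcases Finset.mem_insert.mp hlo_mem with h | h
      · rw [h]; exact hσpos
      · obtain ⟨hloC, hlochi⟩ := Finset.mem_filter.mp h
        by_contra hle
        have hne : prev chi ≠ (w 1 : ℚ) / w 0 := fun e => hσC (e ▸ hloC)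
        have hlt : (w 1 : ℚ) / w 0 < prev chi := lt_of_le_of_ne (not_lt.mp hle) hne.symm
        exact absurd (hchi_le _ hloC hlt) (not_le.mpr hlochi)
    obtain ⟨hb, hsign1⟩ := lower_side D w hw0 (prev chi) hlo_lt (fun d hd h1 h2 =>
      absurd (hlo_ge _ (Finset.mem_insert_of_mem (Finset.mem_filter.mpr
        ⟨hCmem d hd (hlo_nonneg.trans_lt h1), h2.trans hσchi⟩))) (not_le.mpr h1))
    obtain ⟨ha, hsign2⟩ := upper_side D w hw0 chi hσchi (fun d hd h1 h2 =>
      absurd (hchi_le _ (hCmem d hd (hσpos.trans h1)) h1) (not_le.mpr h2))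
    refine ⟨(vec (prev chi), vec chi),
      Finset.mem_insert_of_mem (Finset.mem_image_of_mem _ hchiC), ?_⟩
    simp only [hvec, Matrix.cons_val_zero, Matrix.cons_val_one]
    refine ⟨?_, ha, hb, fun d hd hpos => ⟨hsign1 d hd hpos, hsign2 d hd hpos⟩⟩
    have hs1 : (((prev chi).num : ℤ) : ℚ) / (((prev chi).den : ℤ) : ℚ) = prev chi := by
      rw [Int.cast_natCast]; exact Rat.num_div_den _
    have hs2 : ((chi.num : ℤ) : ℚ) / ((chi.den : ℤ) : ℚ) = chi := by
      rw [Int.cast_natCast]; exact Rat.num_div_den _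
    exact det_pos_of_slope_lt _ _ _ _ (Int.natCast_pos.mpr (prev chi).den_pos)
      (Int.natCast_pos.mpr chi.den_pos) (by rw [hs1, hs2]; exact hlo_lt.trans hσchi)
  · -- the top sector `cmax < σ < ∞`
    have hnoU : ∀ c ∈ C, ¬ (w 1 : ℚ) / w 0 < c :=
      fun c hc hlt => hU ⟨c, Finset.mem_filter.mpr ⟨hc, hlt⟩⟩
    have hmax_nonneg : 0 ≤ cmax := hmax_ge 0 (Finset.mem_insert_self _ _)
    have hmax_lt : cmax < (w 1 : ℚ) / w 0 := by
      rcases Finset.mem_insert.mp hmax_mem with h | h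
      · rw [h]; exact hσpos
      · have hne : cmax ≠ (w 1 : ℚ) / w 0 := fun e => hσC (e ▸ h)
        exact lt_of_le_of_ne (not_lt.mp (hnoU _ h)) hne
    obtain ⟨hb, hsign1⟩ := lower_side D w hw0 cmax hmax_lt (fun d hd h1 _ =>
      absurd (hmax_ge _ (Finset.mem_insert_of_mem (hCmem d hd (hmax_nonneg.trans_lt h1))))
        (not_le.mpr h1))
    have hsign2 := top_side D w hw0 (fun d hd h1 => hnoU _ (hCmem d hd (hσpos.trans h1)) h1)
    refine ⟨(vec cmax, ![0, 1]), Finset.mem_insert_self _ _, ?_⟩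
    simp only [hvec, Matrix.cons_val_zero, Matrix.cons_val_one, mul_one, mul_zero, sub_zero,
      zero_mul, one_mul, zero_add]
    exact ⟨Int.natCast_pos.mpr cmax.den_pos, hw0, hb,
      fun d hd hpos => ⟨hsign1 d hd hpos, hsign2 d hd hpos⟩⟩

/-- `⟨σ w, σ d⟩ = ⟨w, d⟩` for the coordinate reflection `σ = diag(s)`, `sᵢ² = 1`.
[folklore] -/
theorem inner_reflect (s w d : Fin 2 → ℤ) (hs : ∀ i, s i * s i = 1) :
    s 0 * w 0 * (s 0 * d 0) + s 1 * w 1 * (s 1 * d 1) = w 0 * d 0 + w 1 * d 1 := by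
  linear_combination (w 0 * d 0) * hs 0 + (w 1 * d 1) * hs 1

/-- Cramer's rule in `ℤ²`: `det(r₁,r₂) • w = det(w,r₂) • r₁ + det(r₁,w) • r₂`.
[folklore] -/
theorem cramer (w r1 r2 : Fin 2 → ℤ) :
    (r1 0 * r2 1 - r1 1 * r2 0) • w =
      (w 0 * r2 1 - w 1 * r2 0) • r1 + (r1 0 * w 1 - r1 1 * w 0) • r2 := by
  ext i
  fin_cases i <;> simp <;> ring

/-- The quadrant lemma transported to the open quadrant `{sᵢ wᵢ > 0}` by the reflection
`diag(s)`, already in the shape of the stub. [folklore] -/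
theorem quadrant_reflect (D : Finset (Fin 2 → ℤ)) (s : Fin 2 → ℤ)
    (hs : ∀ i, s i * s i = 1) :
    ∃ Sec : Finset ((Fin 2 → ℤ) × (Fin 2 → ℤ)), Sec.card ≤ D.card + 1 ∧
      ∀ w : Fin 2 → ℤ, 0 < s 0 * w 0 → 0 < s 1 * w 1 →
        (∀ d ∈ D, w 0 * d 0 + w 1 * d 1 ≠ 0) →
        ∃ rr ∈ Sec, rr.1 0 * rr.2 1 ≠ rr.1 1 * rr.2 0 ∧
          ∃ a b K : ℤ, 0 < a ∧ 0 < b ∧ 0 < K ∧ K • w = a • rr.1 + b • rr.2 ∧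
            ∀ d ∈ D, 0 < w 0 * d 0 + w 1 * d 1 →
              0 ≤ rr.1 0 * d 0 + rr.1 1 * d 1 ∧ 0 ≤ rr.2 0 * d 0 + rr.2 1 * d 1 := by
  obtain ⟨Sec, hcard, hSec⟩ := quadrant (D.image fun d => s * d)
  refine ⟨Sec.image fun rr => (s * rr.1, s * rr.2),
    Finset.card_image_le.trans (hcard.trans (Nat.add_le_add_right Finset.card_image_le 1)), ?_⟩
  intro w hw0 hw1 hadm
  have hadm' : ∀ d' ∈ D.image (fun d => s * d), (s * w) 0 * d' 0 + (s * w) 1 * d' 1 ≠ 0 := by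
    intro d' hd'
    obtain ⟨d, hd, rfl⟩ := Finset.mem_image.mp hd'
    simp only [Pi.mul_apply]
    rw [inner_reflect s w d hs]
    exact hadm d hd
  obtain ⟨rr, hrr, hK, ha, hb, hsign⟩ := hSec (s * w) hw0 hw1 hadm'
  simp only [Pi.mul_apply] at hK ha hb hsign
  refine ⟨(s * rr.1, s * rr.2), Finset.mem_image_of_mem _ hrr, ?_, _, _, _, ha, hb, hK, ?_, ?_⟩
  · simp only [Pi.mul_apply]
    intro h
    have h0 : rr.1 0 * rr.2 1 - rr.1 1 * rr.2 0 = 0 := by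
      linear_combination (s 0 * s 1) * h
        - (rr.1 0 * rr.2 1 - rr.1 1 * rr.2 0) * (s 1) ^ 2 * hs 0
        - (rr.1 0 * rr.2 1 - rr.1 1 * rr.2 0) * hs 1
    exact absurd h0 hK.ne'
  · have hc := cramer (s * w) rr.1 rr.2
    funext i
    have hci := congrFun hc i
    simp only [Pi.smul_apply, Pi.add_apply, Pi.mul_apply, smul_eq_mul] at hci ⊢
    linear_combination (s i) * hci - ((rr.1 0 * rr.2 1 - rr.1 1 * rr.2 0) * w i) * hs i
  · intro d hd hpos
    have h := hsign (s * d) (Finset.mem_image_of_mem _ hd)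
      (by simp only [Pi.mul_apply]; rw [inner_reflect s w d hs]; exact hpos)
    simp only [Pi.mul_apply] at h ⊢
    exact ⟨h.1.trans_eq (by ring), h.2.trans_eq (by ring)⟩

/-- **SWEEP** (stub `stub_sweep` of the line `corner-log-linearization`).  For a finite
`D ⊂ ℤ²` there are `≤ 4|D| + 4` sectors `(r₁, r₂)` (independent integer boundary vectors)
such that every integer weight `w` off the axes and off all critical lines `⟨w, d⟩ = 0`
satisfies `K • w = a • r₁ + b • r₂` for some integers `a, b, K > 0`, with
`⟨w, d⟩ > 0 ⇒ ⟨r₁, d⟩ ≥ 0 ∧ ⟨r₂, d⟩ ≥ 0` for `d ∈ D`. [folklore] -/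
theorem stub_sweep : ∀ (D : Finset (Fin 2 → ℤ)),
    ∃ Sec : Finset ((Fin 2 → ℤ) × (Fin 2 → ℤ)), Sec.card ≤ 4 * D.card + 4 ∧
      ∀ w : Fin 2 → ℤ, w 0 ≠ 0 → w 1 ≠ 0 → (∀ d ∈ D, w 0 * d 0 + w 1 * d 1 ≠ 0) →
        ∃ rr ∈ Sec, rr.1 0 * rr.2 1 ≠ rr.1 1 * rr.2 0 ∧
          ∃ a b K : ℤ, 0 < a ∧ 0 < b ∧ 0 < K ∧ K • w = a • rr.1 + b • rr.2 ∧
            ∀ d ∈ D, 0 < w 0 * d 0 + w 1 * d 1 →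
              0 ≤ rr.1 0 * d 0 + rr.1 1 * d 1 ∧ 0 ≤ rr.2 0 * d 0 + rr.2 1 * d 1 := by
  intro D
  obtain ⟨S1, hc1, h1⟩ := quadrant_reflect D ![1, 1] (by decide)
  obtain ⟨S2, hc2, h2⟩ := quadrant_reflect D ![1, -1] (by decide)
  obtain ⟨S3, hc3, h3⟩ := quadrant_reflect D ![-1, 1] (by decide)
  obtain ⟨S4, hc4, h4⟩ := quadrant_reflect D ![-1, -1] (by decide)
  refine ⟨S1 ∪ S2 ∪ S3 ∪ S4, ?_, fun w hw0 hw1 hadm => ?_⟩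
  · have e1 := Finset.card_union_le (S1 ∪ S2 ∪ S3) S4
    have e2 := Finset.card_union_le (S1 ∪ S2) S3
    have e3 := Finset.card_union_le S1 S2
    omega
  · rcases lt_or_gt_of_ne hw0 with hn0 | hp0 <;> rcases lt_or_gt_of_ne hw1 with hn1 | hp1
    · obtain ⟨rr, hrr, hrest⟩ := h4 w (by simpa using hn0) (by simpa using hn1) hadm
      exact ⟨rr, by simp [hrr], hrest⟩
    · obtain ⟨rr, hrr, hrest⟩ := h3 w (by simpa using hn0) (by simpa using hp1) hadm
      exact ⟨rr, by simp [hrr], hrest⟩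
    · obtain ⟨rr, hrr, hrest⟩ := h2 w (by simpa using hp0) (by simpa using hn1) hadm
      exact ⟨rr, by simp [hrr], hrest⟩
    · obtain ⟨rr, hrr, hrest⟩ := h1 w (by simpa using hp0) (by simpa using hp1) hadm
      exact ⟨rr, by simp [hrr], hrest⟩

end Summit.ValiantsHypothesis.ValiantsHypothesis.Theorems.TwoProducts.Sweep
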